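import Summits.BirchSwinnertonDyer.BirchSwinnertonDyer.Theorems.Rank2Observatory2DescClKillCurveCertQ2Rows
import Summits.BirchSwinnertonDyer.BirchSwinnertonDyer.Theorems.ShaPrimaryTransferFiniteShaComponentTransferSelmerCubicDoorTransport
import Summits.BirchSwinnertonDyer.BirchSwinnertonDyer.Theorems.ShaPrimaryTransferFiniteShaComponentTransferSelmerCubicKillSelList
import HarnessLib

/-!
# BirchSwinnertonDyer — the SEL2CUBIC door for the TWO-AUXILIARY-PRIME kernel `2`-descent rows WITH A KILL LIST
# (`TwoDescCl.checkK₂ r`, kills in residue form): certificate ⟹ `t₂(E) = 0`, `Ш(E/ℚ)[2^∞] = 0`, `rank E(ℚ) = r`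

HONEST FRAMING: route `ShaPrimaryTransfer`, seat `bsd-line-spt-p1` (g31), `--supports` item T =
`FiniteShaComponentTransfer` (stmt-22356), UNCHANGED (conjecture-grade at corank ≥ 2). BSD in rank ≥ 2 is NOT
proved by any of this. THEOREMS ONLY.

The cell-`b2b-bsdr2` two-auxiliary-prime kernel `2`-descent with a kill list in validity form
(`Rank2Observatory2DescClKillCurveCertQ2{Defs,,Rows}`: `checkK₂ fc cc r ks` = the clauses of `check₂` except the count,
the light kill clauses, `#(adm₂ ∖ killed) < 2^{r+1}`; soundness `rank_le_of_checkK₂` GIVEN `KillValidQ2 fc cc ks` — no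
`p`-primitive INTEGER zero of the quadric pair of each listed class). For a `2`-Selmer class the integer-validity
form says nothing (a Selmer class is everywhere locally soluble); what the residue-tree certificates of the census
(`killCheck`, `sig3/12u/12r/2c/8/2xCheck`) actually prove is the RESIDUE statement «no `p`-primitive `v ∈ ℤ⁴` with
`p^N ∣ Q₁(v), Q₂(v)`», and that IS contradicted by a Selmer class (`admKillsV_sound_sel`, g30). This file runs the
certificate on `Sel⁽²⁾(E/ℚ)` with the kills as residue hypotheses:

* `killValidQ2_of_residue`, `killResidueQ2_entries` — glue between the residue form and the tree's list certificate;
* **`sha_door_of_checkK₂`** — `checkK₂ fc cc r ks ∧ (residue certs) ∧ r ≤ rank ⟹ t₂(E) = 0 ∧ Ш(E/ℚ)[2^∞] = 0 ∧ rank = r`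
  for the model `(0, A, 0, B, C)`. The `K`-free row shapes (`rank_eq_of_certsK₂{,_complSq}`: 589 `TwoDescClQ2K*Rows*`
  rows, 572 of them rank-3 rows with an EMPTY kill list) and the row kit `killResidueQ2_{nil,cons,cons_z}` are in
  `…SelmerCubicQ2Rows`.
[cite: Cassels1991LecturesEllipticCurves, §15] [cite: SilvermanAEC2009, Thm. X.4.2, Rem. X.4.1]
[cite: CremonaAlgorithms1997, §3.6] [cite: Cohen1993, §6.5]
-/

-- single-conjunct summit: `Summit.BirchSwinnertonDyer.BirchSwinnertonDyer.…` repeats the name by design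
set_option linter.dupNamespace false

noncomputable section

open scoped Classical NumberField nonZeroDivisors

open Literature.NumberTheory.NumberFields Literature.NumberTheory.EllipticCurves
  Literature.NumberTheory.GaloisRepresentations Polynomial Module NumberField IsDedekindDomain Ideal
open WeierstrassCurve WeierstrassCurve.Affine

namespace Summit.BirchSwinnertonDyer.BirchSwinnertonDyer.Theorems.ShaPrimaryTransferSelmerCubicCover

open Summit.BirchSwinnertonDyer.BirchSwinnertonDyer.Rank2Observatory
open Summit.BirchSwinnertonDyer.BirchSwinnertonDyer.Rank2Observatory.TwoDescCubic
open Summit.BirchSwinnertonDyer.BirchSwinnertonDyer.Rank2Observatory.TwoDescCl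
open Summit.BirchSwinnertonDyer.BirchSwinnertonDyer.Rank2Observatory.TwoDescCl.ClFieldCertQ2
open Summit.BirchSwinnertonDyer.BirchSwinnertonDyer.Rank2Observatory.TwoDescKill
open Summit.BirchSwinnertonDyer.BirchSwinnertonDyer.Theorems.ShaPrimaryTransferSelmerCubicKill

/-! ## The row door -/

section Row

variable {K : Type} [Field K] [NumberField K] {θ : K}

/-- The kill hypothesis of a two-auxiliary-prime kill row in RESIDUE form («no `p`-primitive integer vector with
`p^N ∣ Q₁, Q₂`») implies the tree's integer-validity `KillValidQ2` (take the exact zero). [folklore] -/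
theorem killValidQ2_of_residue {fc : ClFieldCertQ2} {cc : ClCurveCertQ2} {ks : List ClKill}
    (hk : ∀ k ∈ ks, k.p.Prime ∧ ∃ N : ℕ, ∀ v : ℤ × ℤ × ℤ × ℤ,
      ¬ ((k.p : ℤ) ∣ v.1 ∧ (k.p : ℤ) ∣ v.2.1 ∧ (k.p : ℤ) ∣ v.2.2.1 ∧ (k.p : ℤ) ∣ v.2.2.2) →
      (k.p : ℤ) ^ N ∣ (killQ fc.a fc.b fc.c (k.z₂ fc cc) cc.t.2.1 cc.t.2.2 v).1 →
      (k.p : ℤ) ^ N ∣ (killQ fc.a fc.b fc.c (k.z₂ fc cc) cc.t.2.1 cc.t.2.2 v).2 → False) :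
    KillValidQ2 fc cc ks := by
  intro k hkm
  refine ⟨(hk k hkm).1, ?_⟩
  obtain ⟨N, hN⟩ := (hk k hkm).2
  intro v hprim h0
  exact hN v hprim (by rw [h0]; exact dvd_zero _) (by rw [h0]; exact dvd_zero _)

/-- The residue certificates of the `KillEntry`s of a two-auxiliary-prime kill row. [folklore] -/
theorem killResidueQ2_entries {fc : ClFieldCertQ2} {cc : ClCurveCertQ2} {ks : List ClKill}
    (hk : ∀ k ∈ ks, k.p.Prime ∧ ∃ N : ℕ, ∀ v : ℤ × ℤ × ℤ × ℤ,
      ¬ ((k.p : ℤ) ∣ v.1 ∧ (k.p : ℤ) ∣ v.2.1 ∧ (k.p : ℤ) ∣ v.2.2.1 ∧ (k.p : ℤ) ∣ v.2.2.2) →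
      (k.p : ℤ) ^ N ∣ (killQ fc.a fc.b fc.c (k.z₂ fc cc) cc.t.2.1 cc.t.2.2 v).1 →
      (k.p : ℤ) ^ N ∣ (killQ fc.a fc.b fc.c (k.z₂ fc cc) cc.t.2.1 cc.t.2.2 v).2 → False) :
    ∀ e ∈ killEntries₂ fc cc ks, ∃ N : ℕ, ∀ v : ℤ × ℤ × ℤ × ℤ,
      ¬ ((e.p : ℤ) ∣ v.1 ∧ (e.p : ℤ) ∣ v.2.1 ∧ (e.p : ℤ) ∣ v.2.2.1 ∧ (e.p : ℤ) ∣ v.2.2.2) →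
      (e.p : ℤ) ^ N ∣ (killQ fc.a fc.b fc.c e.z cc.t.2.1 cc.t.2.2 v).1 →
      (e.p : ℤ) ^ N ∣ (killQ fc.a fc.b fc.c e.z cc.t.2.1 cc.t.2.2 v).2 → False := by
  intro e he
  obtain ⟨k, hkm, rfl⟩ := List.mem_map.mp he
  exact (hk k hkm).2

/-- **The SEL2CUBIC door for a `checkK₂ r` row (two auxiliary primes WITH A KILL LIST): `t₂(E) = 0`,
`Ш(E/ℚ)[2^∞] = 0`, `rank E(ℚ) = r`.** For a checked two-prime field record `fc`, a curve record `cc` and raw kills `ks`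
passing `checkK₂ fc cc r ks` (model `E = (0, A, 0, B, C)`), the RESIDUE certificate of every listed kill («no
`p`-primitive integer vector with `p^N ∣ Q₁, Q₂`» — what `killCheck` / `sig*Check` prove, `…KillCertMod*`,
`…KillResidue`) and a lower bound `r ≤ rank E(ℚ)`: the sieve `admK₂ fc cc ks` accepts the Cassels class of every
`2`-Selmer class — `admStd_sound_sel`, four `valRow_sound_sel`, and `admKillsV_sound_sel` for the killed classes (the
local point of a Selmer class contradicts the residue certificate: g30's local Cassels uniformity) — so
`#Sel⁽²⁾(E/ℚ) ≤ #admissible < 2^{r+1}` (`natCard_selmerGroup_le_of_coverSet_cl`) and the strict descent count closes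
(`sha_door_of_natCard_selmerGroup_two_lt`). The decoding of the records is the proof of `rank_le_of_checkK₂` verbatim
(adapted from `Rank2Observatory2DescClKillCurveCertQ2`). Kills certified only in VALIDITY form by a global argument
(`qkCert_sound`, `conicCert_sound`: no RATIONAL point on the `2`-covering) are NOT residue certificates and are not
accepted here. UNCONDITIONAL; BSD is not claimed. [cite: Cassels1991LecturesEllipticCurves, §15]
[cite: SilvermanAEC2009, Thm. X.4.2, Rem. X.4.1] [cite: CremonaAlgorithms1997, §3.6] -/
theorem sha_door_of_checkK₂ (r : ℕ) (fc : ClFieldCertQ2) (hθ : aeval θ (MonicCubic.poly fc.a fc.b fc.c) = 0)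
    (h3 : finrank ℚ K = 3) (hF : fc.check = true) (hpr : fc.primeList.Forall Nat.Prime) (cc : ClCurveCertQ2)
    (ks : List ClKill) (hc : checkK₂ fc cc r ks = true)
    (hk : ∀ k ∈ ks, k.p.Prime ∧ ∃ N : ℕ, ∀ v : ℤ × ℤ × ℤ × ℤ,
      ¬ ((k.p : ℤ) ∣ v.1 ∧ (k.p : ℤ) ∣ v.2.1 ∧ (k.p : ℤ) ∣ v.2.2.1 ∧ (k.p : ℤ) ∣ v.2.2.2) →
      (k.p : ℤ) ^ N ∣ (killQ fc.a fc.b fc.c (k.z₂ fc cc) cc.t.2.1 cc.t.2.2 v).1 →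
      (k.p : ℤ) ^ N ∣ (killQ fc.a fc.b fc.c (k.z₂ fc cc) cc.t.2.1 cc.t.2.2 v).2 → False)
    (hlow : r ≤ ((⟨0, cc.A, 0, cc.B, cc.C⟩ : WeierstrassCurve ℚ)).mordellWeilRank) :
    ((⟨0, cc.A, 0, cc.B, cc.C⟩ : WeierstrassCurve ℚ)).shaCorank 2 = 0 ∧
      AddCommGroup.primaryComponent ((⟨0, cc.A, 0, cc.B, cc.C⟩ : WeierstrassCurve ℚ)).sha 2 = ⊥ ∧
        ((⟨0, cc.A, 0, cc.B, cc.C⟩ : WeierstrassCurve ℚ)).mordellWeilRank = r := by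
  classical
  have hirr := fc.irreducible_of_check hF
  have hq₁ := fc.q₁_prime hpr
  have hq₂ := fc.q₂_prime hpr
  simp only [checkK₂, Bool.and_eq_true, decide_eq_true_eq, List.all_eq_true, List.any_eq_true,
    Bool.or_eq_true, beq_iff_eq] at hc
  obtain ⟨⟨⟨⟨⟨⟨⟨⟨⟨⟨⟨⟨⟨⟨⟨⟨⟨hΔ, hirrF⟩, hcub⟩, hder⟩, hdisc⟩, hND0⟩, hdn⟩, hdnC⟩, hcodes⟩, hdW11⟩, hdW12⟩,
    hdW21⟩, hdW22⟩, hQ⟩, hfamAll⟩, hcert⟩, hlite⟩, hcount⟩ := hc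
  haveI hE := isElliptic_of_deltaShort_ne hΔ
  have hirrF' := irreducible_of_noRootMod hirrF
  -- `θ_E`, `D`, `M = D·q₁q₂`
  have haev := aeval_lin_eq_zero_of_coords hθ cc.t hcub
  have hderiv : (3 : 𝓞 K) * (lin hθ cc.t.1 cc.t.2.1 cc.t.2.2) ^ 2 +
      2 * ((cc.A : ℤ) : 𝓞 K) * (lin hθ cc.t.1 cc.t.2.1 cc.t.2.2) + ((cc.B : ℤ) : 𝓞 K) =
        lin hθ cc.D.1 cc.D.2.1 cc.D.2.2 := by
    simpa using deriv_eq_of_coords hθ cc.t cc.D [] hder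
  have hD0 : (lin hθ cc.D.1 cc.D.2.1 cc.D.2.2 : 𝓞 K) ≠ 0 := lin_ne_zero_of_coords hirr hθ h3 _ hND0
  have hq0 : ((fc.q₁ * fc.q₂ : ℕ) : 𝓞 K) ≠ 0 := by exact_mod_cast (Nat.mul_ne_zero hq₁.ne_zero hq₂.ne_zero)
  have hM0 : (lin hθ cc.D.1 cc.D.2.1 cc.D.2.2 : 𝓞 K) * ((fc.q₁ * fc.q₂ : ℕ) : 𝓞 K) ≠ 0 := mul_ne_zero hD0 hq0
  have hgen := closure_tsupp_eq_top_of_dvd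
    (dvd_mul_left ((fc.q₁ * fc.q₂ : ℕ) : 𝓞 K) (lin hθ cc.D.1 cc.D.2.1 cc.D.2.2))
    (fc.closure_q2_eq_top_of_check hθ h3 hF hpr)
  have hDM : ∀ v : HeightOneSpectrum (𝓞 K), (3 : 𝓞 K) * (lin hθ cc.t.1 cc.t.2.1 cc.t.2.2) ^ 2 +
      2 * ((cc.A : ℤ) : 𝓞 K) * (lin hθ cc.t.1 cc.t.2.1 cc.t.2.2) + ((cc.B : ℤ) : 𝓞 K) ∈ v.asIdeal →
      (lin hθ cc.D.1 cc.D.2.1 cc.D.2.2 : 𝓞 K) * ((fc.q₁ * fc.q₂ : ℕ) : 𝓞 K) ∈ v.asIdeal := by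
    intro v hv
    rw [hderiv] at hv
    exact Ideal.mul_mem_right _ _ hv
  have hDW₁₁ : (lin hθ cc.D.1 cc.D.2.1 cc.D.2.2 : 𝓞 K) ∉ (fc.W₁₁ hθ h3 hF hpr).asIdeal :=
    lin_not_mem_of_invCert hθ _ (W₁₁_asIdeal hθ h3 hF hpr) hdW11
  have hDW₁₂ : (lin hθ cc.D.1 cc.D.2.1 cc.D.2.2 : 𝓞 K) ∉ (fc.W₁₂ hθ h3 hF hpr).asIdeal :=
    lin_not_mem_of_invCert hθ _ (W₁₂_asIdeal hθ h3 hF hpr) hdW12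
  have hDW₂₁ : (lin hθ cc.D.1 cc.D.2.1 cc.D.2.2 : 𝓞 K) ∉ (fc.W₂₁ hθ h3 hF hpr).asIdeal :=
    lin_not_mem_of_invCert hθ _ (W₂₁_asIdeal hθ h3 hF hpr) hdW21
  have hDW₂₂ : (lin hθ cc.D.1 cc.D.2.1 cc.D.2.2 : 𝓞 K) ∉ (fc.W₂₂ hθ h3 hF hpr).asIdeal :=
    lin_not_mem_of_invCert hθ _ (W₂₂_asIdeal hθ h3 hF hpr) hdW22
  -- the support `T = {W₁₁, W₁₂, W₂₁, W₂₂} ∪ codes`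
  set L := cc.codes.length with hL
  let Tf : Fin (L + 4) → HeightOneSpectrum (𝓞 K) := Matrix.vecCons (fc.W₁₁ hθ h3 hF hpr)
    (Matrix.vecCons (fc.W₁₂ hθ h3 hF hpr) (Matrix.vecCons (fc.W₂₁ hθ h3 hF hpr)
      (Matrix.vecCons (fc.W₂₂ hθ h3 hF hpr) fun i => codePrime hθ h3 hF hpr (cc.codes.get i))))
  have hT : ∀ w : HeightOneSpectrum (𝓞 K),
      (lin hθ cc.D.1 cc.D.2.1 cc.D.2.2 : 𝓞 K) * ((fc.q₁ * fc.q₂ : ℕ) : 𝓞 K) ∈ w.asIdeal → ∃ i, Tf i = w := by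
    intro w hw
    rcases w.isPrime.mem_or_mem hw with hD | hqw
    · obtain ⟨l, hl, hldvd, hlw⟩ := exists_prime_dvd_norm_mem w hD0 hD
      rw [natAbs_norm_lin_coords hirr hθ h3, hdn] at hldvd
      obtain ⟨a, ha, hla⟩ := (Prime.dvd_prod_iff hl.prime).mp hldvd
      obtain ⟨pe, hpe, rfl⟩ := List.mem_map.mp ha
      obtain ⟨hany, hrowcodes⟩ := hdnC pe hpe
      have hany' : (fc.primes.any fun e => e.p == pe.1) = true := by simpa [List.any_eq_true] using hany
      obtain ⟨hrow, hrowp⟩ := row_mem hany'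
      have hpp : (fc.row pe.1).p.Prime := fc.prime_of_mem hpr hrow
      have hl_eq : l = pe.1 :=
        (Nat.prime_dvd_prime_iff_eq hl (hrowp ▸ hpp)).mp (hl.dvd_of_dvd_pow hla)
      have hlw' : ((fc.row pe.1).p : 𝓞 K) ∈ w.asIdeal := by rw [hrowp, ← hl_eq]; exact hlw
      obtain ⟨C', hC', hw'⟩ :=
        exists_code_of_natCast_mem hirr hθ h3 hpp (fc.row_check_of_mem hF hrow).1 w hlw'
      rcases hrowcodes C' hC' with hmem | ⟨ci, -, hci, hinv⟩
      · obtain ⟨i, hi⟩ := List.mem_iff_get.mp hmem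
        obtain ⟨hc1, hc2⟩ := hcodes _ (List.get_mem _ i)
        have hc1' : (fc.primes.any fun e => e.p == (cc.codes.get i).1) = true := by
          simpa [List.any_eq_true] using hc1
        refine ⟨i.succ.succ.succ.succ, HeightOneSpectrum.ext ?_⟩
        simp only [Tf, Matrix.cons_val_succ]
        rw [codePrime_asIdeal hθ h3 hF hpr hc1' hc2, hi, hw']
      · exact absurd hD (lin_not_mem_of_invCert hθ w hw' hinv)
    · rw [natCast_q₁q₂] at hqw
      rcases w.isPrime.mem_or_mem hqw with h₁ | h₂
      · rcases eq_W₁₁_or_W₁₂ hθ h3 hF hpr w h₁ with rfl | rfl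
        · exact ⟨0, by simp [Tf]⟩
        · exact ⟨1, by simp [Tf]⟩
      · rcases eq_W₂₁_or_W₂₂ hθ h3 hF hpr w h₂ with rfl | rfl
        · exact ⟨2, by simp [Tf]⟩
        · exact ⟨3, by simp [Tf]⟩
  -- the family
  set fm := fam₂ fc cc with hfm
  let W : Fin fm.length → 𝓞 K := fun j => lin hθ (fm.get j).2.2.g.1 (fm.get j).2.2.g.2.1 (fm.get j).2.2.g.2.2
  have hfam : ∀ j : Fin fm.length, famCheck₂ fc cc.D (fm.get j) = true := fun j => hfamAll _ (List.get_mem _ j)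
  have hW0 : ∀ j, W j ≠ 0 := fun j => lin_ne_zero_of_famCheck₂ hθ h3 hF (hfam j)
  have hWval : ∀ j (v : HeightOneSpectrum (𝓞 K)),
      (lin hθ cc.D.1 cc.D.2.1 cc.D.2.2 : 𝓞 K) * ((fc.q₁ * fc.q₂ : ℕ) : 𝓞 K) ∉ v.asIdeal →
        v.valuation K (algebraMap (𝓞 K) K (W j)) = 1 :=
    fun j v hv => valuation_eq_one_of_support _ _ (supp_of_famCheck₂ hθ h3 hF hpr (hfam j)) v hv
  obtain ⟨ρ, hlo, hhi⟩ := fc.exists_rho_of_check hθ h3 hF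
  -- independence modulo squares: the parity certificate
  have hind : ∀ S : Finset (Fin fm.length), IsSquare (∏ i ∈ S, algebraMap (𝓞 K) K (W i)) → S = ∅ := by
    intro S hS
    refine indep_of_parity_certificate (fun i => algebraMap (𝓞 K) K (W i)) (bit₂ fc cc) ?_ hcert S hS
    intro k S' hS'
    have hS'' : IsSquare (∏ i ∈ S', W i) := isSquare_prod_of_isSquare_prod_coe _ hS'
    obtain ⟨k, hk⟩ := k
    rcases k with _ | _ | _ | _ | _ | k
    · have h := even_card_of_isSquare_real ρ (fun i => algebraMap (𝓞 K) K (W i))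
        (fun i => rho_ne_zero_of_famCheck₂ hθ ρ hlo hhi hF (hfam i)) hS'
      convert h using 2
      refine Finset.filter_congr (fun i _ => ?_)
      exact sign_iff_of_famCheck₂ hθ ρ hlo hhi hF (hfam i)
    · exact even_card_of_isSquare_valuation (fc.W₁₁ hθ h3 hF hpr) W hW0 _
        (fun i => by
          show ((!decide ((2 : ℤ) ∣ famL₁₁ (fm.get i))) = true ↔ _)
          rw [log_W₁₁_of_famCheck₂ hθ h3 hF hpr (hfam i)]; simp) hS'
    · exact even_card_of_isSquare_valuation (fc.W₁₂ hθ h3 hF hpr) W hW0 _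
        (fun i => by
          show ((!decide ((2 : ℤ) ∣ famL₁₂ (fm.get i))) = true ↔ _)
          rw [log_W₁₂_of_famCheck₂ hθ h3 hF hpr (hfam i)]; simp) hS'
    · exact even_card_of_isSquare_valuation (fc.W₂₁ hθ h3 hF hpr) W hW0 _
        (fun i => by
          show ((!decide ((2 : ℤ) ∣ famL₂₁ (fm.get i))) = true ↔ _)
          rw [log_W₂₁_of_famCheck₂ hθ h3 hF hpr (hfam i)]; simp) hS'
    · exact even_card_of_isSquare_valuation (fc.W₂₂ hθ h3 hF hpr) W hW0 _
        (fun i => by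
          show ((!decide ((2 : ℤ) ∣ famL₂₂ (fm.get i))) = true ↔ _)
          rw [log_W₂₂_of_famCheck₂ hθ h3 hF hpr (hfam i)]; simp) hS'
    · have hk' : k < fc.chars.length := by omega
      have hch : fc.chars.getD k ((3 : ℕ), (0 : ℤ), (0 : ℤ)) ∈ fc.chars := by
        rw [List.getD_eq_getElem?_getD, List.getElem?_eq_getElem hk', Option.getD_some]
        exact List.getElem_mem hk'
      obtain ⟨h2, ψ, hψ⟩ := fc.exists_psi_of_check hθ h3 hF hpr hch
      haveI : Fact (fc.chars.getD k (3, 0, 0)).1.Prime := ⟨fc.char_prime hpr hch⟩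
      have h := even_card_filter_eulerBit hθ (ℓ := (fc.chars.getD k (3, 0, 0)).1) (by omega) ψ hψ
        (fun i => (fm.get i).2.2.g) (fun i => not_dvd_evalInt_of_famCheck₂ (hfam i) hch) hS''
      convert h using 2
      exact Finset.filter_congr (fun i _ => Iff.rfl)
  -- spanning of the `T`-units modulo squares
  have hodd : Odd (finrank ℚ K) := by rw [h3]; decide
  have hn : fm.length = NumberField.Units.rank K + 1 + (L + 4) := by
    rw [fc.units_rank_of_check hθ h3 hF]
    simp only [hfm, fam₂, List.length_cons, List.length_map, hL]
    omega
  have hspan : ∀ u : K, u ≠ 0 →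
      (∀ v : HeightOneSpectrum (𝓞 K),
        (lin hθ cc.D.1 cc.D.2.1 cc.D.2.2 : 𝓞 K) * ((fc.q₁ * fc.q₂ : ℕ) : 𝓞 K) ∉ v.asIdeal → v.valuation K u = 1) →
      ∃ U : Finset (Fin fm.length), IsSquare (u * ∏ j ∈ U, algebraMap (𝓞 K) K (W j)) :=
    fun u hu huT => exists_isSquare_tunit_mul_prod hodd _ Tf hT hn (fun j => algebraMap (𝓞 K) K (W j))
      (fun j => RingOfIntegers.coe_ne_zero_iff.mpr (hW0 j)) hWval hind u hu huT
  -- the sieve is sound at rational points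
  haveI hEK : (((⟨0, cc.A, 0, cc.B, cc.C⟩ : WeierstrassCurve ℚ)).baseChange K).IsElliptic := ((⟨0, cc.A, 0, cc.B, cc.C⟩ : WeierstrassCurve ℚ)).isElliptic_baseChange K
  have hΔneg : ((⟨0, cc.A, 0, cc.B, cc.C⟩ : WeierstrassCurve ℚ)).Δ < 0 := by
    rw [Δ_shortModel_eq_sixteen_mul_disc]
    exact_mod_cast (show 16 * MonicCubic.disc cc.A cc.B cc.C < 0 by linarith [hdisc])
  have hadm : ∀ c ∈ selmerGroup ((⟨0, cc.A, 0, cc.B, cc.C⟩ : WeierstrassCurve ℚ)) 2, ∀ a : Kˣ,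
      kummerEquiv K 2 (((⟨0, cc.A, 0, cc.B, cc.C⟩ : WeierstrassCurve ℚ)).oneRootDescentH1 K
        (isTwoTorsionX_of_aeval (A := cc.A) (B := cc.B) (C := cc.C) ((⟨0, cc.A, 0, cc.B, cc.C⟩ : WeierstrassCurve ℚ)) rfl rfl rfl rfl rfl haev) c) =
        Additive.ofMul (QuotientGroup.mk a) →
      ∀ (T : Finset (Fin 0)) (U : Finset (Fin fm.length)),
        IsSquare ((a : K) *
          (∏ i ∈ T, algebraMap (𝓞 K) K (((fun i : Fin 0 => i.elim0 : Fin 0 → (𝓞 K)ˣ) i : (𝓞 K)ˣ) : 𝓞 K)) *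
            ∏ j ∈ U, algebraMap (𝓞 K) K (W j)) → adm₂ fc cc T U = true := by
    intro c hc a ha T U hsq
    have h1 : admStd (fun i : Fin 0 => i.elim0) (famNorm₂ fc cc) (fun i : Fin 0 => i.elim0) (famSign₂ fc cc) T U =
        true :=
      admStd_sound_sel (A := cc.A) (B := cc.B) (C := cc.C) ((⟨0, cc.A, 0, cc.B, cc.C⟩ : WeierstrassCurve ℚ)) rfl rfl rfl rfl rfl hirrF' haev h3 ρ hΔneg (w := fun i : Fin 0 => algebraMap (𝓞 K) K
          (((fun i : Fin 0 => i.elim0 : Fin 0 → (𝓞 K)ˣ) i : (𝓞 K)ˣ) : 𝓞 K))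
        (g := fun j => algebraMap (𝓞 K) K (W j)) (fun i => i.elim0)
        (fun j => RingOfIntegers.coe_ne_zero_iff.mpr (hW0 j)) (fun i => i.elim0)
        (fun j => norm_of_famCheck₂ hθ h3 hF) (fun i => i.elim0)
        (fun j => sign_iff_of_famCheck₂ hθ ρ hlo hhi hF (hfam j)) hc a ha T U hsq
    have h2 := valRow_sound_sel (A := cc.A) (B := cc.B) (C := cc.C) ((⟨0, cc.A, 0, cc.B, cc.C⟩ : WeierstrassCurve ℚ)) rfl rfl rfl rfl rfl haev
      (fc.W₁₁ hθ h3 hF hpr) (by rw [hderiv]; exact hDW₁₁) hW0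
      (r := fun j => bitRow₂ fc (fm.get j) 1) (fun j => by
        show ((!decide ((2 : ℤ) ∣ famL₁₁ (fm.get j))) = true ↔ _)
        rw [show algebraMap (𝓞 K) K (W j) = ((W j : 𝓞 K) : K) from rfl,
          log_W₁₁_of_famCheck₂ hθ h3 hF hpr (hfam j)]; simp) hc a ha T U hsq
    have h3' := valRow_sound_sel (A := cc.A) (B := cc.B) (C := cc.C) ((⟨0, cc.A, 0, cc.B, cc.C⟩ : WeierstrassCurve ℚ)) rfl rfl rfl rfl rfl haev
      (fc.W₁₂ hθ h3 hF hpr) (by rw [hderiv]; exact hDW₁₂) hW0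
      (r := fun j => bitRow₂ fc (fm.get j) 2) (fun j => by
        show ((!decide ((2 : ℤ) ∣ famL₁₂ (fm.get j))) = true ↔ _)
        rw [show algebraMap (𝓞 K) K (W j) = ((W j : 𝓞 K) : K) from rfl,
          log_W₁₂_of_famCheck₂ hθ h3 hF hpr (hfam j)]; simp) hc a ha T U hsq
    have h4' := valRow_sound_sel (A := cc.A) (B := cc.B) (C := cc.C) ((⟨0, cc.A, 0, cc.B, cc.C⟩ : WeierstrassCurve ℚ)) rfl rfl rfl rfl rfl haev
      (fc.W₂₁ hθ h3 hF hpr) (by rw [hderiv]; exact hDW₂₁) hW0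
      (r := fun j => bitRow₂ fc (fm.get j) 3) (fun j => by
        show ((!decide ((2 : ℤ) ∣ famL₂₁ (fm.get j))) = true ↔ _)
        rw [show algebraMap (𝓞 K) K (W j) = ((W j : 𝓞 K) : K) from rfl,
          log_W₂₁_of_famCheck₂ hθ h3 hF hpr (hfam j)]; simp) hc a ha T U hsq
    have h5' := valRow_sound_sel (A := cc.A) (B := cc.B) (C := cc.C) ((⟨0, cc.A, 0, cc.B, cc.C⟩ : WeierstrassCurve ℚ)) rfl rfl rfl rfl rfl haev
      (fc.W₂₂ hθ h3 hF hpr) (by rw [hderiv]; exact hDW₂₂) hW0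
      (r := fun j => bitRow₂ fc (fm.get j) 4) (fun j => by
        show ((!decide ((2 : ℤ) ∣ famL₂₂ (fm.get j))) = true ↔ _)
        rw [show algebraMap (𝓞 K) K (W j) = ((W j : 𝓞 K) : K) from rfl,
          log_W₂₂_of_famCheck₂ hθ h3 hF hpr (hfam j)]; simp) hc a ha T U hsq
    simp only [adm₂, Bool.and_eq_true]
    exact ⟨⟨⟨⟨admStdQ_of_admStd hQ h1, h2⟩, h3'⟩, h4'⟩, h5'⟩
  -- the killed classes: `admKillsV_sound` over the family coordinates (no separate units), validity form
  have hlite' : ∀ k ∈ ks, k.liteV₂ fc cc = true := hlite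
  have hkill := killListCheckV_of_liteV₂ hlite' (killValidQ2_of_residue hk)
  have he₀ : ((1 : ℕ) : K) ^ 2 * algebraMap (𝓞 K) K (lin hθ cc.t.1 cc.t.2.1 cc.t.2.2) =
      evZ θ (cc.t.1, cc.t.2.1, cc.t.2.2) := by
    rw [Nat.cast_one, one_pow, one_mul]
    exact algebraMap_lin_evZ hθ (cc.t.1, cc.t.2.1, cc.t.2.2)
  have hadmK : ∀ c ∈ selmerGroup ((⟨0, cc.A, 0, cc.B, cc.C⟩ : WeierstrassCurve ℚ)) 2, ∀ a : Kˣ,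
      kummerEquiv K 2 (((⟨0, cc.A, 0, cc.B, cc.C⟩ : WeierstrassCurve ℚ)).oneRootDescentH1 K
        (isTwoTorsionX_of_aeval (A := cc.A) (B := cc.B) (C := cc.C) ((⟨0, cc.A, 0, cc.B, cc.C⟩ : WeierstrassCurve ℚ)) rfl rfl rfl rfl rfl haev) c) =
        Additive.ofMul (QuotientGroup.mk a) →
      ∀ (T : Finset (Fin 0)) (U : Finset (Fin fm.length)),
        IsSquare ((a : K) *
          (∏ i ∈ T, algebraMap (𝓞 K) K (((fun i : Fin 0 => i.elim0 : Fin 0 → (𝓞 K)ˣ) i : (𝓞 K)ˣ) : 𝓞 K)) *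
            ∏ j ∈ U, algebraMap (𝓞 K) K (W j)) → admK₂ fc cc ks T U = true := by
    intro c hc a ha T U hsq
    exact admKillsV_sound_sel (A := cc.A) (B := cc.B) (C := cc.C) hirr hθ h3
      ((⟨0, cc.A, 0, cc.B, cc.C⟩ : WeierstrassCurve ℚ)) rfl rfl rfl rfl rfl (lin hθ cc.t.1 cc.t.2.1 cc.t.2.2) haev
      cc.t.1 1 he₀
      (u := fun i : Fin 0 => (((fun i : Fin 0 => i.elim0 : Fin 0 → (𝓞 K)ˣ) i : (𝓞 K)ˣ) : 𝓞 K)) W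
      (cu := noUnitCoords) (cg := famCoords₂ fc cc) (fun i => i.elim0) (fun j => rfl) hkill
      (killResidueQ2_entries hk) (hadm c hc a ha T U hsq) hc a ha hsq
  have hsel := natCard_selmerGroup_le_of_coverSet_cl (A := cc.A) (B := cc.B) (C := cc.C)
    (⟨0, cc.A, 0, cc.B, cc.C⟩ : WeierstrassCurve ℚ) rfl rfl rfl rfl rfl hirrF' haev h3 hM0 hgen hDM hW0 hspan
    (Wu := fun i : Fin 0 => i.elim0) (adm := admK₂ fc cc ks) hadmK
  exact sha_door_of_natCard_selmerGroup_two_lt ((⟨0, cc.A, 0, cc.B, cc.C⟩ : WeierstrassCurve ℚ)) (hsel.trans_lt hcount) hlow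

end Row

end Summit.BirchSwinnertonDyer.BirchSwinnertonDyer.Theorems.ShaPrimaryTransferSelmerCubicCover

end
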